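import Summits.QuantumFields.BalabanUV.T4Continuum.Support.NE7GradientCurrency
import Summits.QuantumFields.BalabanUV.T4Continuum.Support.BlockAverageCurrent
import Literature.MathematicalPhysics.QuantumFieldTheory.Balaban1983to89.B8Ineq132
import HarnessLib

/-!
# T⁴ programme, row NE7 — (158) THE GRADIENT CURRENCY DOCKED TO [Balaban1985RegularSpaces] (1.2): the flat lattice co-differential of the
# plaquette deviation against the gauge-COVARIANT divergence `B8Ineq132.covDiv` (gauge-invariant in norm), and the gradient currency of the
# representative `A₀` (`U^{u₀} = e^{A₀}`) from ITS SUP, THE COVARIANT FLUX DIVERGENCE OF `U`, AND THE LANDAU REACTION (`NE7GradientCurrencyCovariant`)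

Cell `pub-balaban`, rung (B)+1 sub-cell t4, row NE7.  Lineage `b2b-balaban-t4-ne7-p2` (CRUX PROVER NE7 #2 = co-owner of row NE7),
generation 88; third file of the chain (156)–(159) «THE GRADIENT CURRENCY `a₁` OF REP♭ IS NOT AN INDEPENDENT LETTER», over (157)
`NE7GradientCurrency.norm_fdiff_le_of_plaqDiv_periodic'`.

WHY.  (157) bounds `‖∇A‖_∞` for `W = e^{A}` by `4(dρ∕R + R(J + P))` with `J` a bound on the FLAT lattice co-differential
`Σ_μ [(W(∂p_{μν}(x)) − 1) − (W(∂p_{μν}(x−e_μ)) − 1)]` of the plaquette deviation.  The regularity datum a gauge field carries is GAUGE-INVARIANT: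
[Balaban1985RegularSpaces] (1.2) p. 76 `(D^{η*}_U ∂U)_ν(x) = Σ_{μ<ν}(D^{η*}_{U,μ}F_{μν})(x) − Σ_{μ>ν}(D^{η*}_{U,μ}F_{νμ})(x)` (tree: lit-balaban
`B8Ineq132.covDiv η U ν x`, with (1.11) `‖covDiv η U^u‖ = ‖covDiv η U‖`, `B8Ineq132.norm_covDiv_gaugeAct`) — the quantity (1.9) bounds, and the one
the OWNER's R1 `NE7CriticalFirstVariation` controls at the fibre point by tangent-criticality (via the by-parts dictionary R2).  §1 shows the two
divergences differ by SECOND-ORDER terms only: per direction, a transport defect `‖R(W(b))F − F‖ ≤ ε·b₀(2 + b₀)` (`b₀` the bond radius `‖W(b)^{±1} − 1‖`,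
`ε` the plaquette radius) and, for `μ > ν` where (1.2) uses the oppositely ORIENTED plaquette `F_{νμ} = F_{μν}⁻¹`, an inversion defect
`‖(Q⁻¹ − Q′⁻¹) + (Q − Q′)‖ ≤ 2ε²(2 + ε)` — NO regularity is spent on the defects.  §2 docks to THE END's data: `W = U^{u₀} = e^{A₀}` with `u₀` unitary,
so `J ≤ sup‖covDiv 1 U‖ + d·ε·((e^{2a₀} − 1) + 2ε(2 + ε))`, and (157) gives the gradient currency of `A₀` from `a₀`, `sup‖covDiv 1 U‖`, the Landau
reaction gradient and the displayed regime `128·d·R·a₀ ≤ 1` (`R = M`).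

WHAT ([folklore]; 0 def, 0 sorry):
* §1 `hol_plaqWord_swap'`, `norm_conjR_sub_self_le`, `norm_inv_sub_inv_add_sub_le`, `covDiv_one_eq_sum_ite` ((1.2) as ONE sum over all directions),
  **`norm_plaqDivFlat_le_covDiv`**: `‖Σ_μ [(W(∂p_{μν}(x))−1) − (W(∂p_{μν}(x−e_μ))−1)]‖ ≤ ‖covDiv 1 W ν x‖ + d·(ε·b₀(2+b₀) + 2ε²(2+ε))`.
* §2 `norm_expUnit_sub_one_le'` (bond radius of `e^{A}`), **`norm_plaqDivFlat_le_covDiv_gaugeAct`** (`W = U^{u₀} = e^{A₀}`: the right side with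
  `covDiv 1 U` and `b₀ = e^{a₀} − 1`), **`gradient_currency_of_covDiv`** — THE DOCKED GRADIENT CURRENCY: for `U` with `SmallField U ε` and
  `‖covDiv 1 U ν x‖ ≤ j`, a unitary gauge `u₀` and a `Per`-periodic `A₀` with `U^{u₀} = e^{A₀}`, `‖A₀‖ ≤ a₀ ≤ 1∕64`, Landau reaction gradient `≤ r`,
  and `R ≥ 1` with `128·d·R·a₀ ≤ 1`: `‖A₀(y+e_τ)_κ − A₀(y)_κ‖ ≤ 4·(d·a₀∕R + R·(j + d·ε·((e^{2a₀}−1) + 2ε(2+ε)) + r))` everywhere.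

HONEST FRAMING (page 1): elementary lattice ∕ Banach-algebra analysis of OUR objects docked to lit-balaban's typed (1.2); the sup currency `a₀`, the
flux-divergence bound `j` ((1.9) TYPE at the fibre point; = R1 + R2, the latter unwritten) and the Landau reaction `r` ((1.38)∕(1.39) TYPE) are HYPOTHESES;
nothing of Bałaban's asserted; (APE) NOT proved; NE7 NOT PRINTED ∕ NOT PROVED; spine 0∕9; finite T⁴ rung (B)+1 — NOT infinite volume, NOT mass gap, NOT Clay.
Continuum YM on T⁴ ⇐ BetaPertH ∧ nine spine estimates (0/9 proved); BetaPertH ⇐ (D1) ∧ (D4) ∧ CAP+tail; G-an2-4 gates asym, D1 and NE2/3/4.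
No `sorry`; axioms ⊆ {propext, Classical.choice, Quot.sound}.  PLACEMENT: our lemma, under `Summits/QuantumFields/BalabanUV/`.
-/

set_option autoImplicit false

open NormedSpace
open scoped BigOperators Matrix.Norms.L2Operator
open Finset

namespace Summit.QuantumFields.BalabanUV.T4Continuum.NE7GradientCurrencyCovariant

open Literature.MathematicalPhysics.QuantumFieldTheory.Balaban1983to89
open B7Prop1Explicit B7Prop2Explicit
open B7Eq78Linearization (conjR conjR_apply conjR_sub conjR_one)
open B8Ineq132 (covDiv covDeriv plaqF norm_covDiv_gaugeAct)
open T4AveragingDeficitWall (vary SmallField)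
open AveragingDeficitPeriodicCounting (IsPeriodicDir)
open AveragingDeficitTransport (mem_U1_of_unitary)
open BlockAveragePushDirSplit (flat)
open BlockAverageCurrent (smallField_gaugeAct)
open NE7GradientCurrency (norm_conj_sub_self_le vary_flat_one_apply norm_fdiff_le_of_plaqDiv_periodic')

noncomputable section

/-! ## §1 The flat co-differential of the plaquette deviation against the covariant divergence (1.2) -/

section Algebra

variable {𝔸 : Type*} [NormedRing 𝔸] [NormOneClass 𝔸]

omit [NormOneClass 𝔸] in
/-- `‖R(V)Y − Y‖ ≤ (‖V − 1‖·‖V⁻¹‖ + ‖V⁻¹ − 1‖)·‖Y‖` (`VYV⁻¹ − Y = (V − 1)YV⁻¹ + Y(V⁻¹ − 1)`). [folklore] -/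
theorem norm_conjR_sub_self_le (V : 𝔸ˣ) (Y : 𝔸) :
    ‖conjR V Y - Y‖ ≤ (‖(V : 𝔸) - 1‖ * ‖((V⁻¹ : 𝔸ˣ) : 𝔸)‖ + ‖((V⁻¹ : 𝔸ˣ) : 𝔸) - 1‖) * ‖Y‖ := by
  have hid : conjR V Y - Y = ((V : 𝔸) - 1) * Y * ((V⁻¹ : 𝔸ˣ) : 𝔸) + Y * (((V⁻¹ : 𝔸ˣ) : 𝔸) - 1) := by
    rw [conjR_apply]; noncomm_ring
  rw [hid]
  calc _ ≤ ‖((V : 𝔸) - 1) * Y * ((V⁻¹ : 𝔸ˣ) : 𝔸)‖ + ‖Y * (((V⁻¹ : 𝔸ˣ) : 𝔸) - 1)‖ := norm_add_le _ _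
    _ ≤ ‖(V : 𝔸) - 1‖ * ‖Y‖ * ‖((V⁻¹ : 𝔸ˣ) : 𝔸)‖ + ‖Y‖ * ‖((V⁻¹ : 𝔸ˣ) : 𝔸) - 1‖ :=
        add_le_add ((norm_mul_le _ _).trans (mul_le_mul_of_nonneg_right (norm_mul_le _ _) (norm_nonneg _))) (norm_mul_le _ _)
    _ = _ := by ring

/-- **THE INVERSION DEFECT**: for units `Q, Q′` with `‖Q⁻¹ − 1‖, ‖Q′⁻¹ − 1‖ ≤ ε`: `‖(Q⁻¹ − Q′⁻¹) + (Q − Q′)‖ ≤ ε(2 + ε)·‖Q − Q′‖`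
(`Q⁻¹ − Q′⁻¹ = −Q⁻¹(Q − Q′)Q′⁻¹` and (157)'s `norm_conj_sub_self_le`). [folklore] -/
theorem norm_inv_sub_inv_add_sub_le {Q Q' : 𝔸ˣ} {ε : ℝ} (hQ : ‖((Q⁻¹ : 𝔸ˣ) : 𝔸) - 1‖ ≤ ε) (hQ' : ‖((Q'⁻¹ : 𝔸ˣ) : 𝔸) - 1‖ ≤ ε) :
    ‖(((Q⁻¹ : 𝔸ˣ) : 𝔸) - ((Q'⁻¹ : 𝔸ˣ) : 𝔸)) + ((Q : 𝔸) - (Q' : 𝔸))‖ ≤ ε * (2 + ε) * ‖(Q : 𝔸) - (Q' : 𝔸)‖ := by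
  have hid : (((Q⁻¹ : 𝔸ˣ) : 𝔸) - ((Q'⁻¹ : 𝔸ˣ) : 𝔸)) + ((Q : 𝔸) - (Q' : 𝔸))
      = -(((Q⁻¹ : 𝔸ˣ) : 𝔸) * ((Q : 𝔸) - (Q' : 𝔸)) * ((Q'⁻¹ : 𝔸ˣ) : 𝔸) - ((Q : 𝔸) - (Q' : 𝔸))) := by
    rw [mul_sub, sub_mul, Units.inv_mul, one_mul, mul_assoc, Units.mul_inv, mul_one]
    abel
  rw [hid, norm_neg]
  have h := norm_conj_sub_self_le (L := ((Q⁻¹ : 𝔸ˣ) : 𝔸)) (R := ((Q'⁻¹ : 𝔸ˣ) : 𝔸)) (D := (Q : 𝔸) - (Q' : 𝔸))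
    (l := 1 + ε) (r := 1 + ε) (by linarith) (by linarith)
  refine h.trans (le_of_eq ?_)
  ring

end Algebra

section Carriers

variable {d : ℕ} {n : Type*} [Fintype n] [DecidableEq n] [Nonempty n]

omit [Fintype n] [DecidableEq n] [Nonempty n] in
/-- Reversing the orientation of a plaquette inverts its holonomy: `W(∂p_{νμ}(z)) = W(∂p_{μν}(z))⁻¹` (lit-balaban `B16Ineq382WilsonFactor.hol_plaqWord_swap`,
re-derived from `B7Prop1Local.hol_plaqWord_eq` to keep the imports light). [folklore] -/
theorem hol_plaqWord_swap' {G : Type*} [Group G] (V : Site d → Fin d → G) (z : Site d) (μ ν : Fin d) :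
    hol V z (plaqWord ν μ) = (hol V z (plaqWord μ ν))⁻¹ := by
  rw [B7Prop1Local.hol_plaqWord_eq, B7Prop1Local.hol_plaqWord_eq]
  group

omit [Nonempty n] in
/-- **(1.2) AS ONE SUM OVER ALL DIRECTIONS** (at `η = 1`): `covDiv 1 W ν x = Σ_μ c_μ` with `c_μ = R(W(x−e_μ,μ))⁻¹F_{μν}(x−e_μ) − F_{μν}(x)` for `μ < ν`,
`c_μ = −(R(W(x−e_μ,μ))⁻¹F_{νμ}(x−e_μ) − F_{νμ}(x))` for `μ > ν`, `c_ν = 0`. [folklore] -/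
theorem covDiv_one_eq_sum_ite (W : Site d → Fin d → (Matrix n n ℂ)ˣ) (ν : Fin d) (x : Site d) :
    covDiv 1 W ν x = ∑ μ : Fin d,
      (if μ < ν then conjR (W (x - e μ) μ)⁻¹ (plaqF W μ ν (x - e μ)) - plaqF W μ ν x
        else if ν < μ then -(conjR (W (x - e μ) μ)⁻¹ (plaqF W ν μ (x - e μ)) - plaqF W ν μ x) else 0) := by
  classical
  have hsplit : ∀ μ : Fin d,
      (if μ < ν then conjR (W (x - e μ) μ)⁻¹ (plaqF W μ ν (x - e μ)) - plaqF W μ ν x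
        else if ν < μ then -(conjR (W (x - e μ) μ)⁻¹ (plaqF W ν μ (x - e μ)) - plaqF W ν μ x) else 0)
      = (if μ < ν then conjR (W (x - e μ) μ)⁻¹ (plaqF W μ ν (x - e μ)) - plaqF W μ ν x else 0)
        + (if ν < μ then -(conjR (W (x - e μ) μ)⁻¹ (plaqF W ν μ (x - e μ)) - plaqF W ν μ x) else 0) := by
    intro μ
    by_cases h1 : μ < ν
    · have h2 : ¬ ν < μ := lt_asymm h1
      simp [h1, h2]
    · by_cases h2 : ν < μ
      · simp [h1, h2]
      · simp [h1, h2]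
  simp_rw [hsplit]
  rw [Finset.sum_add_distrib, ← Finset.sum_filter, ← Finset.sum_filter, Finset.filter_gt_eq_Iio, Finset.filter_lt_eq_Ioi,
    Finset.sum_neg_distrib]
  unfold covDiv covDeriv
  simp only [inv_one, one_smul]
  rfl

omit [Fintype n] [DecidableEq n] [Nonempty n] in
/-- Bookkeeping: if `S = Σ_μ c_μ` and `‖t_μ + c_μ‖ ≤ K` for every `μ`, then `‖Σ_μ t_μ‖ ≤ ‖S‖ + d·K`. [folklore] -/
theorem norm_sum_le_norm_add_of_termwise {E : Type*} [SeminormedAddCommGroup E] (t c : Fin d → E) {S : E} (hS : S = ∑ μ, c μ)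
    {K : ℝ} (h : ∀ μ, ‖t μ + c μ‖ ≤ K) : ‖∑ μ, t μ‖ ≤ ‖S‖ + d * K := by
  have hsum : ∑ μ, t μ = (∑ μ, (t μ + c μ)) - S := by rw [hS, Finset.sum_add_distrib]; abel
  rw [hsum]
  refine (norm_sub_le _ _).trans ?_
  have h1 : ‖∑ μ, (t μ + c μ)‖ ≤ d * K := by
    refine (norm_sum_le _ _).trans ?_
    calc ∑ μ, ‖t μ + c μ‖ ≤ ∑ _μ : Fin d, K := Finset.sum_le_sum fun μ _ => h μ
      _ = d * K := by rw [Finset.sum_const, Finset.card_univ, Fintype.card_fin, nsmul_eq_mul]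
  linarith

/-- **THE FLAT CO-DIFFERENTIAL OF THE PLAQUETTE DEVIATION AGAINST THE COVARIANT DIVERGENCE (1.2)**: for a configuration `W` whose bond variables
and their inverses are within `b₀` of `1` and whose plaquette variables are within `ε ≥ 0` of `1` (`SmallField W ε`), at every site and component
`‖Σ_μ [(W(∂p_{μν}(x)) − 1) − (W(∂p_{μν}(x−e_μ)) − 1)]‖ ≤ ‖covDiv 1 W ν x‖ + d·(ε·b₀·(2 + b₀) + 2ε²(2 + ε))` — transport defects for every `μ ≠ ν`,
inversion defects for `μ > ν`, nothing for `μ = ν`; no regularity spent. [folklore] -/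
theorem norm_plaqDivFlat_le_covDiv (W : Site d → Fin d → (Matrix n n ℂ)ˣ) {b₀ ε : ℝ} (hε0 : 0 ≤ ε)
    (hWb : ∀ (y : Site d) (μ : Fin d), ‖((W y μ : (Matrix n n ℂ)ˣ) : (Matrix n n ℂ)) - 1‖ ≤ b₀ ∧ ‖(((W y μ)⁻¹ : (Matrix n n ℂ)ˣ) : (Matrix n n ℂ)) - 1‖ ≤ b₀)
    (hWε : SmallField W ε) (x : Site d) (ν : Fin d) :
    ‖∑ μ, ((((hol W x (plaqWord μ ν) : (Matrix n n ℂ)ˣ) : (Matrix n n ℂ)) - 1) - (((hol W (x - e μ) (plaqWord μ ν) : (Matrix n n ℂ)ˣ) : (Matrix n n ℂ)) - 1))‖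
      ≤ ‖covDiv 1 W ν x‖ + d * (ε * b₀ * (2 + b₀) + 2 * ε * ε * (2 + ε)) := by
  classical
  have hb0 : 0 ≤ b₀ := (norm_nonneg _).trans (hWb x ν).1
  have hK0 : 0 ≤ 2 * ε * ε * (2 + ε) := mul_nonneg (mul_nonneg (mul_nonneg (by norm_num) hε0) hε0) (by linarith)
  -- transport defect
  have htrans : ∀ (μ : Fin d) (Y : (Matrix n n ℂ)ˣ), ‖(Y : (Matrix n n ℂ)) - 1‖ ≤ ε →
      ‖conjR (W (x - e μ) μ)⁻¹ (Y : (Matrix n n ℂ)) - (Y : (Matrix n n ℂ))‖ ≤ ε * b₀ * (2 + b₀) := by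
    intro μ Y hY
    have hV1 : ‖(((W (x - e μ) μ)⁻¹ : (Matrix n n ℂ)ˣ) : (Matrix n n ℂ)) - 1‖ ≤ b₀ := (hWb (x - e μ) μ).2
    have hV2 : ‖((((W (x - e μ) μ)⁻¹)⁻¹ : (Matrix n n ℂ)ˣ) : (Matrix n n ℂ)) - 1‖ ≤ b₀ := by rw [inv_inv]; exact (hWb (x - e μ) μ).1
    have hV3 : ‖((((W (x - e μ) μ)⁻¹)⁻¹ : (Matrix n n ℂ)ˣ) : (Matrix n n ℂ))‖ ≤ 1 + b₀ := by
      have h := norm_le_norm_add_norm_sub' ((((W (x - e μ) μ)⁻¹)⁻¹ : (Matrix n n ℂ)ˣ) : (Matrix n n ℂ)) 1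
      rw [norm_one] at h
      linarith
    have hid : conjR (W (x - e μ) μ)⁻¹ (Y : (Matrix n n ℂ)) - (Y : (Matrix n n ℂ)) = conjR (W (x - e μ) μ)⁻¹ ((Y : (Matrix n n ℂ)) - 1) - ((Y : (Matrix n n ℂ)) - 1) := by
      rw [conjR_sub, conjR_one]; abel
    rw [hid]
    refine (norm_conjR_sub_self_le _ _).trans ?_
    calc (‖(((W (x - e μ) μ)⁻¹ : (Matrix n n ℂ)ˣ) : (Matrix n n ℂ)) - 1‖ * ‖((((W (x - e μ) μ)⁻¹)⁻¹ : (Matrix n n ℂ)ˣ) : (Matrix n n ℂ))‖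
            + ‖((((W (x - e μ) μ)⁻¹)⁻¹ : (Matrix n n ℂ)ˣ) : (Matrix n n ℂ)) - 1‖) * ‖(Y : (Matrix n n ℂ)) - 1‖
        ≤ (b₀ * (1 + b₀) + b₀) * ε :=
          mul_le_mul (add_le_add (mul_le_mul hV1 hV3 (norm_nonneg _) hb0) hV2) hY (norm_nonneg _) (by positivity)
      _ = ε * b₀ * (2 + b₀) := by ring
  refine norm_sum_le_norm_add_of_termwise
    (fun μ => (((hol W x (plaqWord μ ν) : (Matrix n n ℂ)ˣ) : (Matrix n n ℂ)) - 1) - (((hol W (x - e μ) (plaqWord μ ν) : (Matrix n n ℂ)ˣ) : (Matrix n n ℂ)) - 1))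
    (fun μ => if μ < ν then conjR (W (x - e μ) μ)⁻¹ (plaqF W μ ν (x - e μ)) - plaqF W μ ν x
      else if ν < μ then -(conjR (W (x - e μ) μ)⁻¹ (plaqF W ν μ (x - e μ)) - plaqF W ν μ x) else 0)
    (covDiv_one_eq_sum_ite W ν x) fun μ => ?_
  -- the termwise bound
  by_cases h1 : μ < ν
  · have hne : μ ≠ ν := ne_of_lt h1
    have hε : ‖((hol W (x - e μ) (plaqWord μ ν) : (Matrix n n ℂ)ˣ) : (Matrix n n ℂ)) - 1‖ ≤ ε := hWε (x - e μ) μ ν hne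
    have hval : ((((hol W x (plaqWord μ ν) : (Matrix n n ℂ)ˣ) : (Matrix n n ℂ)) - 1) - (((hol W (x - e μ) (plaqWord μ ν) : (Matrix n n ℂ)ˣ) : (Matrix n n ℂ)) - 1))
        + (if μ < ν then conjR (W (x - e μ) μ)⁻¹ (plaqF W μ ν (x - e μ)) - plaqF W μ ν x
            else if ν < μ then -(conjR (W (x - e μ) μ)⁻¹ (plaqF W ν μ (x - e μ)) - plaqF W ν μ x) else 0)
        = conjR (W (x - e μ) μ)⁻¹ (plaqF W μ ν (x - e μ)) - plaqF W μ ν (x - e μ) := by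
      simp only [h1, ↓reduceIte, plaqF]; abel
    rw [hval]
    exact (htrans μ (hol W (x - e μ) (plaqWord μ ν)) hε).trans (le_add_of_nonneg_right hK0)
  · by_cases h2 : ν < μ
    · have hne : ν ≠ μ := ne_of_lt h2
      have hne' : μ ≠ ν := hne.symm
      -- `Q = W(∂p_{νμ}(x))`, `Q' = W(∂p_{νμ}(x − e_μ))`; the flat terms carry their inverses
      have hQi : hol W x (plaqWord μ ν) = (hol W x (plaqWord ν μ))⁻¹ := hol_plaqWord_swap' W x ν μ
      have hQ'i : hol W (x - e μ) (plaqWord μ ν) = (hol W (x - e μ) (plaqWord ν μ))⁻¹ := hol_plaqWord_swap' W (x - e μ) ν μ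
      have eQ : ‖((hol W x (plaqWord ν μ) : (Matrix n n ℂ)ˣ) : (Matrix n n ℂ)) - 1‖ ≤ ε := hWε x ν μ hne
      have eQ' : ‖((hol W (x - e μ) (plaqWord ν μ) : (Matrix n n ℂ)ˣ) : (Matrix n n ℂ)) - 1‖ ≤ ε := hWε (x - e μ) ν μ hne
      have eQi : ‖(((hol W x (plaqWord ν μ))⁻¹ : (Matrix n n ℂ)ˣ) : (Matrix n n ℂ)) - 1‖ ≤ ε := by rw [← hQi]; exact hWε x μ ν hne'
      have eQ'i : ‖(((hol W (x - e μ) (plaqWord ν μ))⁻¹ : (Matrix n n ℂ)ˣ) : (Matrix n n ℂ)) - 1‖ ≤ ε := by rw [← hQ'i]; exact hWε (x - e μ) μ ν hne'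
      have hval : ((((hol W x (plaqWord μ ν) : (Matrix n n ℂ)ˣ) : (Matrix n n ℂ)) - 1) - (((hol W (x - e μ) (plaqWord μ ν) : (Matrix n n ℂ)ˣ) : (Matrix n n ℂ)) - 1))
          + (if μ < ν then conjR (W (x - e μ) μ)⁻¹ (plaqF W μ ν (x - e μ)) - plaqF W μ ν x
              else if ν < μ then -(conjR (W (x - e μ) μ)⁻¹ (plaqF W ν μ (x - e μ)) - plaqF W ν μ x) else 0)
          = (((((hol W x (plaqWord ν μ))⁻¹ : (Matrix n n ℂ)ˣ) : (Matrix n n ℂ)) - (((hol W (x - e μ) (plaqWord ν μ))⁻¹ : (Matrix n n ℂ)ˣ) : (Matrix n n ℂ)))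
              + (((hol W x (plaqWord ν μ) : (Matrix n n ℂ)ˣ) : (Matrix n n ℂ)) - ((hol W (x - e μ) (plaqWord ν μ) : (Matrix n n ℂ)ˣ) : (Matrix n n ℂ))))
            - (conjR (W (x - e μ) μ)⁻¹ ((hol W (x - e μ) (plaqWord ν μ) : (Matrix n n ℂ)ˣ) : (Matrix n n ℂ))
                - ((hol W (x - e μ) (plaqWord ν μ) : (Matrix n n ℂ)ˣ) : (Matrix n n ℂ))) := by
        simp only [h1, h2, ↓reduceIte, plaqF, hQi, hQ'i]
        abel
      rw [hval]
      refine (norm_sub_le _ _).trans ?_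
      have hA := norm_inv_sub_inv_add_sub_le eQi eQ'i
      have hB := htrans μ (hol W (x - e μ) (plaqWord ν μ)) eQ'
      have hQQ' : ‖((hol W x (plaqWord ν μ) : (Matrix n n ℂ)ˣ) : (Matrix n n ℂ)) - ((hol W (x - e μ) (plaqWord ν μ) : (Matrix n n ℂ)ˣ) : (Matrix n n ℂ))‖ ≤ 2 * ε := by
        have h : ((hol W x (plaqWord ν μ) : (Matrix n n ℂ)ˣ) : (Matrix n n ℂ)) - ((hol W (x - e μ) (plaqWord ν μ) : (Matrix n n ℂ)ˣ) : (Matrix n n ℂ))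
            = (((hol W x (plaqWord ν μ) : (Matrix n n ℂ)ˣ) : (Matrix n n ℂ)) - 1) - (((hol W (x - e μ) (plaqWord ν μ) : (Matrix n n ℂ)ˣ) : (Matrix n n ℂ)) - 1) := by abel
        rw [h]
        exact (norm_sub_le _ _).trans (by linarith)
      have hA' : ‖((((hol W x (plaqWord ν μ))⁻¹ : (Matrix n n ℂ)ˣ) : (Matrix n n ℂ)) - (((hol W (x - e μ) (plaqWord ν μ))⁻¹ : (Matrix n n ℂ)ˣ) : (Matrix n n ℂ)))
            + (((hol W x (plaqWord ν μ) : (Matrix n n ℂ)ˣ) : (Matrix n n ℂ)) - ((hol W (x - e μ) (plaqWord ν μ) : (Matrix n n ℂ)ˣ) : (Matrix n n ℂ)))‖ ≤ 2 * ε * ε * (2 + ε) := by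
        refine hA.trans ?_
        have hε2 : 0 ≤ ε * (2 + ε) := mul_nonneg hε0 (by linarith)
        calc ε * (2 + ε) * ‖((hol W x (plaqWord ν μ) : (Matrix n n ℂ)ˣ) : (Matrix n n ℂ)) - ((hol W (x - e μ) (plaqWord ν μ) : (Matrix n n ℂ)ˣ) : (Matrix n n ℂ))‖
            ≤ ε * (2 + ε) * (2 * ε) := mul_le_mul_of_nonneg_left hQQ' hε2
          _ = 2 * ε * ε * (2 + ε) := by ring
      linarith
    · -- `μ = ν`: everything vanishes
      have hμν : μ = ν := le_antisymm (not_lt.mp h2) (not_lt.mp h1)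
      subst hμν
      have hval : ((((hol W x (plaqWord μ μ) : (Matrix n n ℂ)ˣ) : (Matrix n n ℂ)) - 1) - (((hol W (x - e μ) (plaqWord μ μ) : (Matrix n n ℂ)ˣ) : (Matrix n n ℂ)) - 1))
          + (if μ < μ then conjR (W (x - e μ) μ)⁻¹ (plaqF W μ μ (x - e μ)) - plaqF W μ μ x
              else if μ < μ then -(conjR (W (x - e μ) μ)⁻¹ (plaqF W μ μ (x - e μ)) - plaqF W μ μ x) else 0) = 0 := by
        simp only [lt_irrefl, ↓reduceIte, hol_plaqWord_self, Units.val_one, sub_self, add_zero]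
      rw [hval, norm_zero]
      exact add_nonneg (mul_nonneg (mul_nonneg hε0 hb0) (by linarith)) hK0

end Carriers

/-! ## §2 Docking to THE END's data: `W = U^{u₀} = e^{A₀}` -/

section Dock

variable {d : ℕ} {n : Type*} [Fintype n] [DecidableEq n] [Nonempty n]

omit [Nonempty n] in
/-- The bond radius of `e^{A}`: `‖e^{A(b)} − 1‖ ≤ e^{a} − 1` and `‖e^{−A(b)} − 1‖ ≤ e^{a} − 1` on `‖A(b)‖ ≤ a`. [folklore] -/
theorem norm_expUnit_sub_one_le' {X : (Matrix n n ℂ)} {a : ℝ} (hX : ‖X‖ ≤ a) :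
    ‖((expUnit X : (Matrix n n ℂ)ˣ) : (Matrix n n ℂ)) - 1‖ ≤ Real.exp a - 1 ∧ ‖(((expUnit X)⁻¹ : (Matrix n n ℂ)ˣ) : (Matrix n n ℂ)) - 1‖ ≤ Real.exp a - 1 := by
  refine ⟨(norm_exp_sub_one_le_of_norm_le hX).1, ?_⟩
  rw [val_inv_expUnit, val_expUnit]
  exact (norm_exp_sub_one_le_of_norm_le (by rwa [norm_neg] : ‖-X‖ ≤ a)).1

/-- **THE FLAT CO-DIFFERENTIAL OF THE REPRESENTATIVE'S PLAQUETTE DEVIATION AGAINST THE COVARIANT DIVERGENCE OF `U`**: for `U` with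
`SmallField U ε`, a unitary gauge `u₀` and `A₀` with `U^{u₀} = e^{A₀}` (`gaugeAct u₀ U = vary flat A₀ 1`), `‖A₀‖ ≤ a₀`: at every site and component
the datum `J` of (157) for `W = e^{A₀}` is at most `‖covDiv 1 U ν x‖ + d·ε·((e^{2a₀} − 1) + 2ε(2 + ε))` ((1.11): the norm of (1.2) is gauge
invariant). [folklore] -/
theorem norm_plaqDivFlat_le_covDiv_gaugeAct {U : Site d → Fin d → (Matrix n n ℂ)ˣ} {ε : ℝ} (hε0 : 0 ≤ ε) (hUε : SmallField U ε)
    {u₀ : Site d → (Matrix n n ℂ)ˣ} (hu₀ : ∀ y : Site d, u₀ y ∈ unitaryUnits (Matrix n n ℂ)) {A₀ : Site d → Fin d → (Matrix n n ℂ)}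
    (hgauge₀ : gaugeAct u₀ U = vary (flat (d := d) (n := n)) A₀ 1) {a₀ : ℝ} (ha₀ : ∀ (y : Site d) (κ : Fin d), ‖A₀ y κ‖ ≤ a₀)
    (x : Site d) (ν : Fin d) :
    ‖∑ μ, ((((hol (vary (flat (d := d) (n := n)) A₀ 1) x (plaqWord μ ν) : (Matrix n n ℂ)ˣ) : (Matrix n n ℂ)) - 1)
            - (((hol (vary (flat (d := d) (n := n)) A₀ 1) (x - e μ) (plaqWord μ ν) : (Matrix n n ℂ)ˣ) : (Matrix n n ℂ)) - 1))‖
      ≤ ‖covDiv 1 U ν x‖ + d * (ε * ((Real.exp (2 * a₀) - 1) + 2 * ε * (2 + ε))) := by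
  have hWε : SmallField (vary (flat (d := d) (n := n)) A₀ 1) ε := by rw [← hgauge₀]; exact smallField_gaugeAct hu₀ hUε
  have hWb : ∀ (y : Site d) (μ : Fin d), ‖((vary (flat (d := d) (n := n)) A₀ 1 y μ : (Matrix n n ℂ)ˣ) : (Matrix n n ℂ)) - 1‖ ≤ Real.exp a₀ - 1 ∧
      ‖(((vary (flat (d := d) (n := n)) A₀ 1 y μ)⁻¹ : (Matrix n n ℂ)ˣ) : (Matrix n n ℂ)) - 1‖ ≤ Real.exp a₀ - 1 := fun y μ => by
    rw [vary_flat_one_apply]; exact norm_expUnit_sub_one_le' (ha₀ y μ)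
  have h := norm_plaqDivFlat_le_covDiv (vary (flat (d := d) (n := n)) A₀ 1) hε0 hWb hWε x ν
  have hcov : ‖covDiv 1 (vary (flat (d := d) (n := n)) A₀ 1) ν x‖ = ‖covDiv 1 U ν x‖ := by
    rw [← hgauge₀]; exact norm_covDiv_gaugeAct 1 (fun y => mem_U1_of_unitary (hu₀ y)) U ν x
  rw [hcov] at h
  refine h.trans (le_of_eq ?_)
  have he : Real.exp a₀ - 1 + 2 = Real.exp a₀ + 1 := by ring
  rw [show (2 : ℝ) * a₀ = a₀ + a₀ by ring, Real.exp_add]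
  ring

/-- **THE DOCKED GRADIENT CURRENCY OF THE REPRESENTATIVE.**  For `d ≥ 1`, a configuration `U` with `SmallField U ε` and covariant flux divergence
`‖covDiv 1 U ν x‖ ≤ j` ([Balaban1985RegularSpaces] (1.2)∕(1.9) TYPE — at the fibre point the OWNER's R1 `NE7CriticalFirstVariation` + the by-parts
dictionary), a unitary gauge `u₀` and a `Per`-periodic representative `A₀` (`Per ≥ 1`) with `U^{u₀} = e^{A₀}`, sup currency `‖A₀‖ ≤ a₀ ≤ 1∕64`,
Landau reaction gradient `‖div A₀(x+e_ν) − div A₀(x)‖ ≤ r`, and a radius `R ≥ 1` in the regime `128·d·R·a₀ ≤ 1`: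
`‖A₀(y+e_τ)_κ − A₀(y)_κ‖ ≤ 4·(d·a₀∕R + R·(j + d·ε·((e^{2a₀} − 1) + 2ε(2 + ε)) + r))` at every site, component and direction.  With `R = M = L^{k+1}`,
`a₀ = s∕M`, `ε = δ∕M²`, `j = c∕M³`, `r = r′∕M³`: the GRADIENT CURRENCY `a₁ ≲ (ds + c + r′ + sδ)∕M²` of REP♭ from its SUP currency. [folklore] -/
theorem gradient_currency_of_covDiv (hd : 1 ≤ d) {U : Site d → Fin d → (Matrix n n ℂ)ˣ} {ε j : ℝ} (hε0 : 0 ≤ ε) (hUε : SmallField U ε)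
    (hcov : ∀ (ν : Fin d) (x : Site d), ‖covDiv 1 U ν x‖ ≤ j)
    {u₀ : Site d → (Matrix n n ℂ)ˣ} (hu₀ : ∀ y : Site d, u₀ y ∈ unitaryUnits (Matrix n n ℂ)) {A₀ : Site d → Fin d → (Matrix n n ℂ)}
    (hgauge₀ : gaugeAct u₀ U = vary (flat (d := d) (n := n)) A₀ 1) {Per : ℕ} (hPer : 1 ≤ Per) (hA₀P : IsPeriodicDir A₀ (Per : ℤ))
    {a₀ r : ℝ} (ha₀ : ∀ (y : Site d) (κ : Fin d), ‖A₀ y κ‖ ≤ a₀) (ha₀s : a₀ ≤ 1 / 64)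
    (hdiv : ∀ (x : Site d) (ν : Fin d), ‖∑ μ, (A₀ (x + e ν) μ - A₀ (x + e ν - e μ) μ) - ∑ μ, (A₀ x μ - A₀ (x - e μ) μ)‖ ≤ r)
    {R : ℕ} (hR : 1 ≤ R) (hreg : 128 * (d : ℝ) * R * a₀ ≤ 1) (y : Site d) (κ τ : Fin d) :
    ‖A₀ (y + e τ) κ - A₀ y κ‖ ≤ 4 * ((d : ℝ) * a₀ / R + R * ((j + d * (ε * ((Real.exp (2 * a₀) - 1) + 2 * ε * (2 + ε)))) + r)) :=
  norm_fdiff_le_of_plaqDiv_periodic' hd hPer A₀ hA₀P ha₀s ha₀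
    (fun x ν => (norm_plaqDivFlat_le_covDiv_gaugeAct hε0 hUε hu₀ hgauge₀ ha₀ x ν).trans (add_le_add (hcov ν x) le_rfl)) hdiv hR hreg y κ τ

end Dock

end

end Summit.QuantumFields.BalabanUV.T4Continuum.NE7GradientCurrencyCovariant
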